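import Literature.Probability.LatticeModels.CorrelationDecayProofs
import Literature.Probability.LatticeModels.IsingExponents
import HarnessLib

/-!
# Ising critical exponents: discharges of the named facts of `IsingExponents`

Sibling proof file of `Literature.Probability.LatticeModels.IsingExponents` (which, containing
definitions, is review-gated; proofs live here). It discharges the two (identical) named facts

* `Literature.Probability.LatticeModels.HasIsingExponentEta.of_bounded` and its dot-notation alias
  `Literature.Probability.LatticeModels.HasIsingEtaBounds.hasIsingExponentEta` — two-sided power-law bounds
  `c ‖x‖^{-(d-2+η)} ≤ ⟨σ₀σ_x⟩⁺_{β_c,0} ≤ C ‖x‖^{-(d-2+η)}` (`HasIsingEtaBounds d η`) imply that `η` is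
  the anomalous dimension in the logarithmic sense
  `log ⟨σ₀σ_x⟩_{β_c} / log ‖x‖ → -(d - 2 + η)` (`HasIsingExponentEta d η`),

as `HasIsingExponentEta.of_bounded_holds` and `HasIsingEtaBounds.hasIsingExponentEta_holds`, both
one-line specialisations of `IsPowerBounded.hasSpatialDecayExponent_holds`
(`CorrelationDecayProofs`) to `G = criticalTwoPoint d`, `κ = d - 2 + η`; plus the corollary
`HasIsingEtaBounds.hasIsingExponentEta'` with the bound as an explicit hypothesis.

Source check: Friedli–Velenik (2017) define critical exponents as log-ratio limits (§2.5.3,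
pp. 77–78: `b = lim_{β↓β_c} log m*(β) / log (β - β_c)`, likewise `γ`, `δ`, `α`) and discuss the
Ising exponents in §3.10.11, pp. 172–173 (Table 3.1); the implication "two-sided power bounds ⇒
logarithmic exponent" is elementary and not a numbered result there (nor in Grimmett (1999), §9.1,
p. 233, which fixes the same logarithmic convention, eq. (9.2)). The vendored statement is
faithful and holds for every `d` (for `d = 0`, `Site 0` is finite and `cofinite = ⊥`).
-/

noncomputable section

open Filter Topology

namespace Literature.Probability.LatticeModels

variable {d : ℕ}

/-- Discharge of the named fact `HasIsingExponentEta.of_bounded`: `HasIsingEtaBounds d η` implies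
`HasIsingExponentEta d η`. One-line specialisation of
`IsPowerBounded.hasSpatialDecayExponent_holds`. Elementary; the logarithmic convention for
exponents is Friedli–Velenik (2017), §2.5.3, pp. 77–78 and §3.10.11, pp. 172–173. [cite: FriedliVelenik2017, §3.10.11] -/
theorem HasIsingExponentEta.of_bounded_holds : HasIsingExponentEta.of_bounded (d := d) :=
  fun h => IsPowerBounded.hasSpatialDecayExponent_holds h

/-- Discharge of the named fact `HasIsingEtaBounds.hasIsingExponentEta` (dot-notation alias of
`HasIsingExponentEta.of_bounded`). Elementary; Friedli–Velenik (2017), §3.10.11. [cite: FriedliVelenik2017, §3.10.11] -/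
theorem HasIsingEtaBounds.hasIsingExponentEta_holds :
    HasIsingEtaBounds.hasIsingExponentEta (d := d) :=
  fun h => HasIsingExponentEta.of_bounded_holds h

/-- Corollary form with the bound as an explicit hypothesis (dot notation on
`HasIsingEtaBounds`): `HasIsingEtaBounds d η → HasIsingExponentEta d η`.
Elementary; Friedli–Velenik (2017), §3.10.11. [cite: FriedliVelenik2017, §3.10.11] -/
theorem HasIsingEtaBounds.hasIsingExponentEta' {η : ℝ} (h : HasIsingEtaBounds d η) :
    HasIsingExponentEta d η :=
  HasIsingExponentEta.of_bounded_holds h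

end Literature.Probability.LatticeModels
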